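import Summits.QuantumFields.BalabanUV.Gaps.EndTopRunFadingMemory
import Summits.QuantumFields.BalabanUV.Gaps.EndUpperPerLevel

/-!
# Gaps / EndUpperFreeCooperative — under (G)'s letters (cooperative in the earlier couplings + Lipschitz `M` in the last, `M·γ₀³ < 2`) the END
# criterion END ⟺ top-runs holds with NO upper-bound binder: the per-level bound is automatic (`Gaps/EndUpperPerLevel`) and non-crossing comes
# from (H) `EndTopRunFadingMemory.hord_of_cooperative_lastLipschitz` — a PORT into the tree, with attribution, of g1-plan-2 GEN 17's lens kernel
# `HOME/g1/skeletons/XreadHordFadingMemory_plan2.lean` (v1.8, sha16 4a2dd778a9e40b0b, the last two declarations of §11; lens item S-44 ∕ R-36 (iii))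
# (cell pub-balaban-gaps, seat g1-p3 gen 7, row CAP+tail ∕ β-currency «split ∕ weakening»; file 6 of «the binder census of the END roads», kept apart
# from `Gaps/EndUpperPerLevel` so that that leaf imports (D) only)

HONEST FRAMING (cell rule, page 1 of everything): [folklore] real analysis over the tree's typed carriers (`FlowStep.HBeta` ∕ `Box` ∕ `RGEqH` ∕
`ofMarkov`, `DagBinding.EndpointExistence` ∕ `modelOf`).  AUTHORSHIP: the mathematics and the Lean text of both declarations below are g1-plan-2
GEN 17's (planner seat; planners file nothing on the ledger by mandate — «provers may port»); this seat's contribution is the port (namespace,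
imports, this header) and the kernel re-check against the tree.  (C), cooperative dependence on the earlier couplings and the Lipschitz letter are
BINDERS (hypothesis SHAPES): for Bałaban's β the upper bound is PRINTED uniformly and smoothness in the last coupling is asserted ([I] §1 pp.
263–264), while the dependence on the earlier couplings is only said to exist (p. 298) — NOTHING of Bałaban's is asserted; 0∕6 binders; 0
coefficients certified; one finite T⁴; NOT B12 Thm 2, NOT `BetaPertH`, NOT the continuum limit, NOT Clay.

THE POINT (g1-plan-2 S-44 ∕ R-36 (iii)).  `Gaps/EndUpperPerLevel.perLevelUpper_of_cooperative_lastLipschitz`: cooperative past + Lipschitz `M`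
in the last coupling ⟹ `β_k ≤ β_k(γ₀,…,γ₀) + M·γ₀` on `Box γ₀ k`; `Gaps/EndTopRunFadingMemory.hord_of_cooperative_lastLipschitz`: the same two
letters with `M·γ₀³ < 2` ⟹ (D)'s `hord`; `Gaps/EndUpperPerLevel.endpointExistence_modelOf_iff_topRuns_locUpper` then gives END ⟺ top-runs for
`modelOf β` from {`0 < γ₀`, (C), cooperative, Lipschitz, `M·γ₀³ < 2`} — (U) and `0 ≤ β′` have DROPPED OUT
(**`endpointExistence_modelOf_iff_topRuns_of_cooperative_lastLipschitz_noUpper`**; Markov: `endpointExistence_ofMarkov_iff_topRuns_of_lipschitz_noUpper`,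
cf. (D)'s `endpointExistence_ofMarkov_iff_topRuns` which asks `BetaUpperH β′`).  In the (U) census of `Gaps/EndUpperLetterWitness`: NONE under
(G)'s letters.
0 sorry; 0 def; imports (H) `Gaps/EndTopRunFadingMemory` + `Gaps/EndUpperPerLevel`; restates nothing of the tree.

CITATION HEADER (tags CONTEXT ONLY).  [I] = T. Bałaban, Commun. Math. Phys. **109** (1987) [Balaban1987RG1]: Thm 2 p. 259, §1 pp. 263–264,
§5 p. 298.
-/

namespace Summit.QuantumFields.BalabanUV.Gaps.EndUpperFreeCooperative

open Literature.MathematicalPhysics.QuantumFieldTheory.Balaban1983to89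
open Literature.MathematicalPhysics.QuantumFieldTheory.Balaban1983to89.FlowStep
open Literature.MathematicalPhysics.QuantumFieldTheory.Balaban1983to89.FlowStepRuns
open Literature.MathematicalPhysics.QuantumFieldTheory.Balaban1983to89.DagBinding
open Summit.QuantumFields.BalabanUV.Gaps.EndRunwiseShooting
open Summit.QuantumFields.BalabanUV.Gaps.EndTopRunCriterion
open Summit.QuantumFields.BalabanUV.Gaps.EndTopRunFadingMemory
open Summit.QuantumFields.BalabanUV.Gaps.EndUpperPerLevel
open Finset

noncomputable section

/-! ## §1 END ⟺ top-runs under (G)'s letters with NO upper-bound binder (g1-plan-2 kernel §11, last two declarations, ported) -/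

/-- **THE END CRITERION UNDER (G)'s LETTERS WITH NO UPPER-BOUND BINDER**: cooperative in the earlier couplings + Lipschitz `M` in the last with
`M·γ₀³ < 2` ((H)'s g-currency smallness) + (C) + `0 < γ₀` ⟹ END ⟺ top-runs, for `modelOf β`.  (U) and `0 ≤ β′` have DROPPED OUT.
[cite: Balaban1987RG1, Thm 2 p.259 and §1 p.263] -/
theorem endpointExistence_modelOf_iff_topRuns_of_cooperative_lastLipschitz_noUpper {β : HBeta} {γ₀ M : ℝ} (hγ₀ : 0 < γ₀)
    (hcont : BetaContH γ₀ β)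
    (hcoop : ∀ (k : ℕ) (v v' : Fin (k + 1) → ℝ), v ∈ Box γ₀ k → v' ∈ Box γ₀ k → (∀ i, v i ≤ v' i) →
      v (Fin.last k) = v' (Fin.last k) → β k v ≤ β k v')
    (hlast : ∀ (k : ℕ) (v : Fin (k + 1) → ℝ), v ∈ Box γ₀ k → ∀ x y : ℝ, 0 < x → x ≤ γ₀ → 0 < y → y ≤ γ₀ →
      |β k (Function.update v (Fin.last k) x) - β k (Function.update v (Fin.last k) y)| ≤ M * |x - y|)
    (hM : 0 ≤ M) (hsmall : M * γ₀ ^ 3 < 2) :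
    EndpointExistence (modelOf β) ↔
      ∃ γ₂ : ℝ, 0 < γ₂ ∧ ∀ γ : ℝ, 0 < γ → γ ≤ γ₂ → ∃ gstar : ℝ, 0 < gstar ∧
        ∀ (n : ℕ) (gs : ℕ → ℝ), RGEqH n β gs → Step.InInterval γ n gs → ∀ k, k ≤ n → gs k = γ → gstar ≤ gs n :=
  endpointExistence_modelOf_iff_topRuns_locUpper hγ₀ hcont (perLevelUpper_of_cooperative_lastLipschitz hγ₀ hcoop hlast hM)
    (hord_of_cooperative_lastLipschitz hγ₀ hcoop hlast hM hsmall)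

/-- Markov + Lipschitz, NO upper-bound binder: for `β_{k+1}(g_0,…,g_k) = βM (k+1) g_k` with `βM (k+1)` Lipschitz `M` on `]0,γ₀]`,
`M·γ₀³ < 2`, continuous on the boxes: END ⟺ top-runs. [cite: Balaban1987RG1, Thm 2 p.259 and §1 p.263] -/
theorem endpointExistence_ofMarkov_iff_topRuns_of_lipschitz_noUpper {βM : ℕ → ℝ → ℝ} {γ₀ M : ℝ} (hγ₀ : 0 < γ₀)
    (hcont : BetaContH γ₀ (ofMarkov βM))
    (hlip : ∀ (k : ℕ) (x y : ℝ), 0 < x → x ≤ γ₀ → 0 < y → y ≤ γ₀ → |βM (k + 1) x - βM (k + 1) y| ≤ M * |x - y|)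
    (hM : 0 ≤ M) (hsmall : M * γ₀ ^ 3 < 2) :
    EndpointExistence (modelOf (ofMarkov βM)) ↔
      ∃ γ₂ : ℝ, 0 < γ₂ ∧ ∀ γ : ℝ, 0 < γ → γ ≤ γ₂ → ∃ gstar : ℝ, 0 < gstar ∧
        ∀ (n : ℕ) (gs : ℕ → ℝ), RGEqH n (ofMarkov βM) gs → Step.InInterval γ n gs →
          ∀ k, k ≤ n → gs k = γ → gstar ≤ gs n := by
  refine endpointExistence_modelOf_iff_topRuns_of_cooperative_lastLipschitz_noUpper hγ₀ hcont ?_ ?_ hM hsmall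
  · intro k v v' _ _ _ hlastEq
    show βM (k + 1) (v (Fin.last k)) ≤ βM (k + 1) (v' (Fin.last k))
    rw [hlastEq]
  · intro k v _ x y hx hxγ hy hyγ
    show |βM (k + 1) (Function.update v (Fin.last k) x (Fin.last k)) -
        βM (k + 1) (Function.update v (Fin.last k) y (Fin.last k))| ≤ M * |x - y|
    rw [Function.update_self, Function.update_self]
    exact hlip k x y hx hxγ hy hyγ

end

end Summit.QuantumFields.BalabanUV.Gaps.EndUpperFreeCooperative
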